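import Literature.Combinatorics.SetFamily.LowMeetingSubset
import Mathlib.Data.Fintype.BigOperators
import Mathlib.Algebra.BigOperators.Ring.Finset
import Mathlib.Data.Nat.Factorial.Basic
import Mathlib.Data.ZMod.Defs
import Mathlib.Analysis.SpecialFunctions.Pow.Real
import HarnessLib

/-!
# Block version of the low-meeting subset lemma, and the support-weight enumerator `(1 + (q−1)ε)^m`

Topic `Literature/Combinatorics/SetFamily`.  Two elementary counting facts (union bound / first
moment, [AlonSpencer2016, Ch. 1 "The Basic Method"]; instances supplied here).

**§1 Block selector.**  Let `S l` (`l : κ`, a finite index type) be pairwise disjoint blocks of a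
ground type, each of size `≥ s`, and let `m j` (`j ∈ mons`) be a finite family of sets each meeting
`⋃_l S l` in at most `ρ` points.  Choose independently and uniformly an `f`-subset `G l ⊆ S l` of every
block.  A fixed `(d+1)`-set `T ⊆ ⋃_l S l` lies in `⋃_l G l` iff `T ∩ S l ⊆ G l` for every `l`
(disjointness), which happens for `Π_l C(|S l| − t_l, f − t_l)` of the `Π_l C(|S l|, f)` choices
(`t_l = |T ∩ S l|`, `Σ_l t_l = d + 1`); and `C(s' − t, f − t)·s^t ≤ C(s', f)·f^t` for
`t ≤ f ≤ s ≤ s'` (`Nat.choose_sub_mul_pow_le`).  Hence the number of BAD choices (some `m j` meets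
`⋃ G l` in `≥ d + 1` points) times `s^{d+1}` is at most `#mons · C(ρ, d+1) · f^{d+1}` times the number
of all choices, and

* `exists_blocks_forall_card_inter_le` — if `#mons · C(ρ, d+1) · f^{d+1} < s^{d+1}` (and
  `d + 1 ≤ f ≤ s`), some choice `(G l ⊆ S l, |G l| = f)_l` has `|m j ∩ ⋃_l G l| ≤ d` for EVERY
  `j ∈ mons`.  (One block, `κ = Unit`, is `exists_subset_forall_card_inter_le` of
  `LowMeetingSubset.lean` in the normalisation `#mons·C(ρ,d+1)·(f/s)^{d+1} < 1`.)

**§2 Support-weight enumerator.**  For a finite type `A` with a zero and `ε` in a commutative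
semiring, `Σ_{t : Fin m → A} ε^{#{i : t i ≠ 0}} = (1 + (|A| − 1)·ε)^m` (`sum_pow_card_ne_zero`;
product of the one-coordinate sums); for `A = ZMod 3`: `Σ_{t ≠ 0} ε^{|t|₀} = (1 + 2ε)^m − 1`
(`sum_erase_zero_pow_card_ne_zero_zmod_three`), and the elementary estimate
`(1 + x)^m − 1 ≤ m·x·(1 + x)^{m−1}` for `x ≥ 0` (`one_add_pow_sub_one_le`).

Provenance / use: asked by the cell qa-qnc0 (planner qa-qnc0-p1, ROUND-33 §3.2 / §6 ask W-35b,
2026-08-29) for the multi-hub frame argument `MultiHubFrameHard`: one global set `F = ⋃_l F_l`,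
`F_l ⊆ supp V_l` of size `f` in each of the pairwise disjoint hub supports, met by every row in
`≤ k` points, and the multiplicative error budget `Σ_{t ≠ 0} (N^{−3})^{|t|₀} = (1 + 2N^{−3})^m − 1`
over the frozen hub values `t : Fin m → ZMod 3`.  The statements are elementary and not tied to
that application.

## References
* [AlonSpencer2016] N. Alon, J. H. Spencer, *The Probabilistic Method*, 4th ed., Wiley 2016, Ch. 1
  ("The Basic Method": union bound / first moment over a uniformly random object) — the instances
  for independent uniformly random `f`-subsets of disjoint blocks are supplied here.
-/

namespace Literature.Combinatorics.SetFamily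

open Finset

/-! ### §0 Two binomial inequalities -/

/-- `f^{\underline t}·s^t ≤ s^{\underline t}·f^t` for `f ≤ s` (falling factorials):
`Π_{k<t} (f − k)/f ≤ Π_{k<t} (s − k)/s`.
[cite: AlonSpencer2016, Ch. 1 «The Basic Method» — elementary estimate supplied here] -/
theorem Nat.descFactorial_mul_pow_le {f s : ℕ} (hfs : f ≤ s) :
    ∀ t : ℕ, f.descFactorial t * s ^ t ≤ s.descFactorial t * f ^ t
  | 0 => by simp
  | t + 1 => by
      have ih := Nat.descFactorial_mul_pow_le hfs t
      rw [Nat.descFactorial_succ, Nat.descFactorial_succ, pow_succ, pow_succ]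
      -- `(f − t)·s ≤ (s − t)·f`
      have hlin : (f - t) * s ≤ (s - t) * f := by
        rcases le_or_gt t f with htf | htf
        · have h1 : (f - t) * s + t * s = f * s := by rw [← Nat.add_mul, Nat.sub_add_cancel htf]
          have h2 : (s - t) * f + t * f = s * f := by
            rw [← Nat.add_mul, Nat.sub_add_cancel (htf.trans hfs)]
          have h3 : t * f ≤ t * s := Nat.mul_le_mul_left _ hfs
          have h4 : f * s = s * f := Nat.mul_comm _ _
          omega
        · rw [Nat.sub_eq_zero_of_le htf.le, zero_mul]; exact Nat.zero_le _
      calc (f - t) * f.descFactorial t * (s ^ t * s)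
          = ((f - t) * s) * (f.descFactorial t * s ^ t) := by ring
        _ ≤ ((s - t) * f) * (s.descFactorial t * f ^ t) := Nat.mul_le_mul hlin ih
        _ = (s - t) * s.descFactorial t * (f ^ t * f) := by ring

/-- **`C(s' − t, f − t)·s^t ≤ C(s', f)·f^t` for `t ≤ f ≤ s ≤ s'`** — the number of `f`-subsets of an
`s'`-set containing a fixed `t`-set is at most a `(f/s)^t` fraction of all `f`-subsets.
(`C(s', f)·C(f, t) = C(s', t)·C(s' − t, f − t)` and `Nat.descFactorial_mul_pow_le`.)
[cite: AlonSpencer2016, Ch. 1 «The Basic Method» — elementary estimate supplied here] -/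
theorem Nat.choose_sub_mul_pow_le {t f s s' : ℕ} (htf : t ≤ f) (hfs : f ≤ s) (hss' : s ≤ s') :
    (s' - t).choose (f - t) * s ^ t ≤ s'.choose f * f ^ t := by
  have hfs' : f ≤ s' := hfs.trans hss'
  -- `C(s', f)·C(f, t) = C(s', t)·C(s' − t, f − t)`
  have hmul : s'.choose f * f.choose t = s'.choose t * (s' - t).choose (f - t) := Nat.choose_mul htf
  -- multiply the goal by `s'.descFactorial t = t! · C(s', t) > 0`
  have hpos : 0 < s'.descFactorial t := by
    rw [Nat.descFactorial_eq_factorial_mul_choose]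
    exact Nat.mul_pos (Nat.factorial_pos _) (Nat.choose_pos (htf.trans hfs'))
  refine Nat.le_of_mul_le_mul_right ?_ hpos
  have hdf := Nat.descFactorial_mul_pow_le hfs' t
  have hst : s ^ t ≤ s' ^ t := Nat.pow_le_pow_left hss' t
  calc (s' - t).choose (f - t) * s ^ t * s'.descFactorial t
      = (s'.choose t * (s' - t).choose (f - t)) * t.factorial * s ^ t := by
        rw [Nat.descFactorial_eq_factorial_mul_choose]; ring
    _ = s'.choose f * (t.factorial * f.choose t) * s ^ t := by rw [← hmul]; ring
    _ = s'.choose f * (f.descFactorial t * s ^ t) := by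
        rw [← Nat.descFactorial_eq_factorial_mul_choose]; ring
    _ ≤ s'.choose f * (f.descFactorial t * s' ^ t) :=
        Nat.mul_le_mul_left _ (Nat.mul_le_mul_left _ hst)
    _ ≤ s'.choose f * (s'.descFactorial t * f ^ t) := Nat.mul_le_mul_left _ hdf
    _ = s'.choose f * f ^ t * s'.descFactorial t := by ring

/-! ### §1 The block selector -/

section Blocks

variable {α ι κ : Type*} [DecidableEq α] [Fintype κ] [DecidableEq κ]

omit [DecidableEq κ] in
/-- For pairwise disjoint blocks, `|T ∩ ⋃_l S l| = Σ_l |T ∩ S l|`.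
[cite: AlonSpencer2016, Ch. 1 «The Basic Method» — bookkeeping supplied here] -/
theorem card_inter_biUnion_eq_sum (S : κ → Finset α) (hS : ∀ l l', l ≠ l' → Disjoint (S l) (S l'))
    (T : Finset α) : (T ∩ univ.biUnion S).card = ∑ l, (T ∩ S l).card := by
  rw [inter_biUnion, card_biUnion]
  intro l _ l' _ hll'
  exact disjoint_of_subset_left inter_subset_right
    (disjoint_of_subset_right inter_subset_right (hS l l' hll'))

/-- If `G l ⊆ S l` for all `l`, the blocks `S l` are pairwise disjoint and `T ⊆ ⋃_l G l`, then
`T ∩ S l ⊆ G l` for every block.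
[cite: AlonSpencer2016, Ch. 1 «The Basic Method» — bookkeeping supplied here] -/
theorem inter_subset_of_subset_biUnion (S G : κ → Finset α)
    (hS : ∀ l l', l ≠ l' → Disjoint (S l) (S l')) (hG : ∀ l, G l ⊆ S l) {T : Finset α}
    (hT : T ⊆ univ.biUnion G) (l : κ) : T ∩ S l ⊆ G l := by
  intro a ha
  rw [mem_inter] at ha
  obtain ⟨l', -, hl'⟩ := mem_biUnion.1 (hT ha.1)
  by_cases h : l' = l
  · subst h; exact hl'
  · exact absurd (hG l' hl') (disjoint_right.1 (hS l' l h) ha.2)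

/-- The choices `(G l)_l`, `G l ⊆ S l`, `|G l| = f`, whose union contains a fixed set `T`, number at
most `Π_l C(|S l| − |T ∩ S l|, f − |T ∩ S l|)`.
[cite: AlonSpencer2016, Ch. 1 «The Basic Method» (counting the choices through a fixed set) — this instance supplied here] -/
theorem card_piFinset_filter_superset_le (S : κ → Finset α)
    (hS : ∀ l l', l ≠ l' → Disjoint (S l) (S l')) (f : ℕ) (T : Finset α) :
    ((Fintype.piFinset fun l => (S l).powersetCard f).filter (fun G => T ⊆ univ.biUnion G)).card
      ≤ ∏ l, ((S l).card - (T ∩ S l).card).choose (f - (T ∩ S l).card) := by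
  calc ((Fintype.piFinset fun l => (S l).powersetCard f).filter (fun G => T ⊆ univ.biUnion G)).card
      ≤ (Fintype.piFinset fun l => ((S l).powersetCard f).filter fun Gl => T ∩ S l ⊆ Gl).card := by
        refine card_le_card fun G hG => ?_
        rw [mem_filter, Fintype.mem_piFinset] at hG
        rw [Fintype.mem_piFinset]
        intro l
        refine mem_filter.2 ⟨hG.1 l, ?_⟩
        exact inter_subset_of_subset_biUnion S G hS (fun l' => (mem_powersetCard.1 (hG.1 l')).1) hG.2 l
    _ = ∏ l, (((S l).powersetCard f).filter fun Gl => T ∩ S l ⊆ Gl).card := Fintype.card_piFinset _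
    _ ≤ ∏ l, ((S l).card - (T ∩ S l).card).choose (f - (T ∩ S l).card) := by
        refine prod_le_prod (fun l _ => Nat.zero_le _) fun l _ => ?_
        have h := card_powersetCard_superset_le (S l) (T ∩ S l) f
        rwa [card_sdiff_of_subset inter_subset_right] at h

omit [DecidableEq α] [DecidableEq κ] in
/-- The product step: if `Σ_l t_l = d + 1`, `d + 1 ≤ f ≤ s ≤ |S l|`, then
`(Π_l C(|S l| − t_l, f − t_l))·s^{d+1} ≤ (Π_l C(|S l|, f))·f^{d+1}`.
[cite: AlonSpencer2016, Ch. 1 «The Basic Method» — elementary estimate supplied here] -/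
theorem prod_choose_sub_mul_pow_le (S : κ → Finset α) (t : κ → ℕ) {d f s : ℕ}
    (ht : ∑ l, t l = d + 1) (hdf : d + 1 ≤ f) (hfs : f ≤ s) (hs : ∀ l, s ≤ (S l).card) :
    (∏ l, ((S l).card - t l).choose (f - t l)) * s ^ (d + 1)
      ≤ (∏ l, (S l).card.choose f) * f ^ (d + 1) := by
  have htl : ∀ l, t l ≤ f := fun l =>
    ((single_le_sum (fun l' _ => Nat.zero_le (t l')) (mem_univ l)).trans ht.le).trans hdf
  rw [← ht, ← prod_pow_eq_pow_sum, ← prod_pow_eq_pow_sum, ← prod_mul_distrib, ← prod_mul_distrib]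
  exact prod_le_prod (fun l _ => Nat.zero_le _)
    fun l _ => Nat.choose_sub_mul_pow_le (htl l) hfs (hs l)

/-- **Block selector (union bound over independent uniform `f`-subsets of disjoint blocks).**
Blocks `S l` pairwise disjoint with `s ≤ |S l|`; a family `m j` (`j ∈ mons`) with
`|m j ∩ ⋃_l S l| ≤ ρ`; `d + 1 ≤ f ≤ s`.  If `#mons · C(ρ, d+1) · f^{d+1} < s^{d+1}` then there are
`G l ⊆ S l`, `|G l| = f`, with `|m j ∩ ⋃_l G l| ≤ d` for every `j ∈ mons`.
Proof: otherwise every choice `G ∈ Π_l C(S l, f)` has a member `m j` meeting `⋃ G l` in a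
`(d+1)`-set `T ⊆ m j ∩ ⋃ S l` (`≤ C(ρ, d+1)` of them); double count the pairs `(G, j)` with
`card_piFinset_filter_superset_le` and `prod_choose_sub_mul_pow_le`.
[cite: AlonSpencer2016, Ch. 1 «The Basic Method» (union bound over a uniformly random choice) — this instance supplied here] -/
theorem exists_blocks_forall_card_inter_le (S : κ → Finset α)
    (hS : ∀ l l', l ≠ l' → Disjoint (S l) (S l')) (mons : Finset ι) (m : ι → Finset α)
    (ρ d f s : ℕ) (hρ : ∀ j ∈ mons, (m j ∩ univ.biUnion S).card ≤ ρ)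
    (hdf : d + 1 ≤ f) (hfs : f ≤ s) (hs : ∀ l, s ≤ (S l).card)
    (hcount : mons.card * ρ.choose (d + 1) * f ^ (d + 1) < s ^ (d + 1)) :
    ∃ G : κ → Finset α, (∀ l, G l ⊆ S l ∧ (G l).card = f) ∧
      ∀ j ∈ mons, (m j ∩ univ.biUnion G).card ≤ d := by
  by_contra hno
  push Not at hno
  set Ω := Fintype.piFinset fun l => (S l).powersetCard f with hΩ
  -- every choice has a bad member
  have hbad : ∀ G ∈ Ω, 1 ≤ (mons.filter fun j => d + 1 ≤ (m j ∩ univ.biUnion G).card).card := by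
    intro G hG
    rw [Fintype.mem_piFinset] at hG
    obtain ⟨j, hj, hlt⟩ := hno G fun l => mem_powersetCard.1 (hG l)
    exact card_pos.2 ⟨j, mem_filter.2 ⟨hj, by omega⟩⟩
  have h1 : Ω.card ≤ ∑ G ∈ Ω, (mons.filter fun j => d + 1 ≤ (m j ∩ univ.biUnion G).card).card := by
    calc Ω.card = ∑ G ∈ Ω, 1 := by simp
      _ ≤ _ := sum_le_sum hbad
  -- double counting
  have h2 : ∑ G ∈ Ω, (mons.filter fun j => d + 1 ≤ (m j ∩ univ.biUnion G).card).card
      = ∑ j ∈ mons, (Ω.filter fun G => d + 1 ≤ (m j ∩ univ.biUnion G).card).card :=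
    sum_card_bipartiteAbove_eq_sum_card_bipartiteBelow (fun G j => d + 1 ≤ (m j ∩ univ.biUnion G).card)
  -- per member: through the `(d+1)`-subsets `T ⊆ m j ∩ ⋃ S l`
  have h3 : ∀ j ∈ mons, (Ω.filter fun G => d + 1 ≤ (m j ∩ univ.biUnion G).card).card * s ^ (d + 1)
      ≤ ρ.choose (d + 1) * (Ω.card * f ^ (d + 1)) := by
    intro j hj
    have hcover : (Ω.filter fun G => d + 1 ≤ (m j ∩ univ.biUnion G).card)
        ⊆ ((m j ∩ univ.biUnion S).powersetCard (d + 1)).biUnion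
            fun T => Ω.filter fun G => T ⊆ univ.biUnion G := by
      intro G hG
      rw [mem_filter] at hG
      have hGS : ∀ l, G l ⊆ S l := fun l => (mem_powersetCard.1 (Fintype.mem_piFinset.1 hG.1 l)).1
      obtain ⟨T, hT, hTcard⟩ := exists_subset_card_eq hG.2
      rw [mem_biUnion]
      refine ⟨T, mem_powersetCard.2 ⟨fun a ha => ?_, hTcard⟩,
        mem_filter.2 ⟨hG.1, fun a ha => (mem_inter.1 (hT ha)).2⟩⟩
      have haG := (mem_inter.1 (hT ha)).2
      obtain ⟨l, -, hl⟩ := mem_biUnion.1 haG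
      exact mem_inter.2 ⟨(mem_inter.1 (hT ha)).1, mem_biUnion.2 ⟨l, mem_univ l, hGS l hl⟩⟩
    have hstep : ∀ T ∈ (m j ∩ univ.biUnion S).powersetCard (d + 1),
        (Ω.filter fun G => T ⊆ univ.biUnion G).card * s ^ (d + 1) ≤ Ω.card * f ^ (d + 1) := by
      intro T hT
      rw [mem_powersetCard] at hT
      have hTS : T ⊆ univ.biUnion S := fun a ha => (mem_inter.1 (hT.1 ha)).2
      have hsum : ∑ l, (T ∩ S l).card = d + 1 := by
        rw [← card_inter_biUnion_eq_sum S hS T, inter_eq_left.2 hTS, hT.2]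
      calc (Ω.filter fun G => T ⊆ univ.biUnion G).card * s ^ (d + 1)
          ≤ (∏ l, ((S l).card - (T ∩ S l).card).choose (f - (T ∩ S l).card)) * s ^ (d + 1) :=
            Nat.mul_le_mul_right _ (card_piFinset_filter_superset_le S hS f T)
        _ ≤ (∏ l, (S l).card.choose f) * f ^ (d + 1) :=
            prod_choose_sub_mul_pow_le S (fun l => (T ∩ S l).card) hsum hdf hfs hs
        _ = Ω.card * f ^ (d + 1) := by
            rw [hΩ, Fintype.card_piFinset]; simp only [card_powersetCard]
    calc (Ω.filter fun G => d + 1 ≤ (m j ∩ univ.biUnion G).card).card * s ^ (d + 1)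
        ≤ (∑ T ∈ (m j ∩ univ.biUnion S).powersetCard (d + 1),
            (Ω.filter fun G => T ⊆ univ.biUnion G).card) * s ^ (d + 1) :=
          Nat.mul_le_mul_right _ ((card_le_card hcover).trans card_biUnion_le)
      _ = ∑ T ∈ (m j ∩ univ.biUnion S).powersetCard (d + 1),
            (Ω.filter fun G => T ⊆ univ.biUnion G).card * s ^ (d + 1) := sum_mul _ _ _
      _ ≤ ∑ _T ∈ (m j ∩ univ.biUnion S).powersetCard (d + 1), Ω.card * f ^ (d + 1) :=
          sum_le_sum hstep
      _ = (m j ∩ univ.biUnion S).card.choose (d + 1) * (Ω.card * f ^ (d + 1)) := by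
          rw [sum_const, card_powersetCard, smul_eq_mul]
      _ ≤ ρ.choose (d + 1) * (Ω.card * f ^ (d + 1)) :=
          Nat.mul_le_mul_right _ (Nat.choose_le_choose _ (hρ j hj))
  have h4 : (∑ j ∈ mons, (Ω.filter fun G => d + 1 ≤ (m j ∩ univ.biUnion G).card).card) * s ^ (d + 1)
      ≤ mons.card * (ρ.choose (d + 1) * (Ω.card * f ^ (d + 1))) := by
    rw [sum_mul, ← smul_eq_mul, ← sum_const]
    exact sum_le_sum h3
  -- `Ω` is non-empty
  have hΩpos : 0 < Ω.card := by
    rw [hΩ, Fintype.card_piFinset]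
    refine prod_pos fun l _ => ?_
    rw [card_powersetCard]
    exact Nat.choose_pos (hfs.trans (hs l))
  have h5 : Ω.card * s ^ (d + 1) ≤ Ω.card * (mons.card * ρ.choose (d + 1) * f ^ (d + 1)) := by
    calc Ω.card * s ^ (d + 1)
        ≤ (∑ j ∈ mons, (Ω.filter fun G => d + 1 ≤ (m j ∩ univ.biUnion G).card).card) * s ^ (d + 1) :=
          Nat.mul_le_mul_right _ (h1.trans h2.le)
      _ ≤ mons.card * (ρ.choose (d + 1) * (Ω.card * f ^ (d + 1))) := h4
      _ = Ω.card * (mons.card * ρ.choose (d + 1) * f ^ (d + 1)) := by ring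
  exact absurd (Nat.le_of_mul_le_mul_left h5 hΩpos) (not_le.2 hcount)

/-- The block selector with the counting hypothesis stated over `ℝ`
(`#mons · C(ρ, d+1) · f^{d+1} < s^{d+1}` as real numbers), the form in which asymptotic estimates
are usually checked.
[cite: AlonSpencer2016, Ch. 1 «The Basic Method» (union bound over a uniformly random choice) — this instance supplied here] -/
theorem exists_blocks_forall_card_inter_le_real (S : κ → Finset α)
    (hS : ∀ l l', l ≠ l' → Disjoint (S l) (S l')) (mons : Finset ι) (m : ι → Finset α)
    (ρ d f s : ℕ) (hρ : ∀ j ∈ mons, (m j ∩ univ.biUnion S).card ≤ ρ)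
    (hdf : d + 1 ≤ f) (hfs : f ≤ s) (hs : ∀ l, s ≤ (S l).card)
    (hcount : (mons.card : ℝ) * (ρ.choose (d + 1) : ℝ) * (f : ℝ) ^ (d + 1) < (s : ℝ) ^ (d + 1)) :
    ∃ G : κ → Finset α, (∀ l, G l ⊆ S l ∧ (G l).card = f) ∧
      ∀ j ∈ mons, (m j ∩ univ.biUnion G).card ≤ d := by
  refine exists_blocks_forall_card_inter_le S hS mons m ρ d f s hρ hdf hfs hs ?_
  exact_mod_cast hcount

end Blocks

/-! ### §2 The support-weight enumerator -/

section Weight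

variable {A : Type*} [Fintype A] [DecidableEq A] [Zero A]

omit [Fintype A] in
/-- `ε^{#{i : t i ≠ 0}} = Π_i (if t i = 0 then 1 else ε)`.
[cite: AlonSpencer2016, Ch. 1 «The Basic Method» — bookkeeping supplied here] -/
theorem pow_card_ne_zero_eq_prod {R : Type*} [CommMonoid R] {m : ℕ} (ε : R) (t : Fin m → A) :
    ε ^ (univ.filter fun i => t i ≠ 0).card = ∏ i, (if t i = 0 then (1 : R) else ε) := by
  rw [prod_ite, prod_const_one, one_mul, prod_const]

/-- **Support-weight enumerator.**  `Σ_{t : Fin m → A} ε^{#{i : t i ≠ 0}} = (1 + (|A| − 1)·ε)^m`.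
[cite: AlonSpencer2016, Ch. 1 «The Basic Method» — elementary identity supplied here] -/
theorem sum_pow_card_ne_zero {R : Type*} [CommSemiring R] (m : ℕ) (ε : R) :
    ∑ t : Fin m → A, ε ^ (univ.filter fun i => t i ≠ 0).card
      = (1 + ((Fintype.card A - 1 : ℕ) : R) * ε) ^ m := by
  have hone : ∑ a : A, (if a = 0 then (1 : R) else ε) = 1 + ((Fintype.card A - 1 : ℕ) : R) * ε := by
    rw [← Finset.add_sum_erase univ _ (mem_univ (0 : A)), if_pos rfl]
    congr 1
    rw [sum_congr rfl fun a ha => if_neg (ne_of_mem_erase ha), sum_const, card_erase_of_mem (mem_univ _),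
      card_univ, nsmul_eq_mul]
  rw [← hone, sum_pow', Fintype.piFinset_univ]
  exact sum_congr rfl fun t _ => pow_card_ne_zero_eq_prod ε t

/-- The `ZMod 3` reading: `Σ_{t : Fin m → ZMod 3} ε^{|t|₀} = (1 + 2ε)^m`.
[cite: AlonSpencer2016, Ch. 1 «The Basic Method» — elementary identity supplied here] -/
theorem sum_pow_card_ne_zero_zmod_three {R : Type*} [CommSemiring R] (m : ℕ) (ε : R) :
    ∑ t : Fin m → ZMod 3, ε ^ (univ.filter fun i => t i ≠ 0).card = (1 + 2 * ε) ^ m := by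
  rw [sum_pow_card_ne_zero]
  norm_num

/-- **The multiplicative budget over the non-zero frozen values.**
`Σ_{t ≠ 0} ε^{|t|₀} = (1 + 2ε)^m − 1` (`t : Fin m → ZMod 3`).
[cite: AlonSpencer2016, Ch. 1 «The Basic Method» — elementary identity supplied here] -/
theorem sum_erase_zero_pow_card_ne_zero_zmod_three {R : Type*} [CommRing R] (m : ℕ) (ε : R) :
    ∑ t ∈ (univ : Finset (Fin m → ZMod 3)).erase 0, ε ^ (univ.filter fun i => t i ≠ 0).card
      = (1 + 2 * ε) ^ m - 1 := by
  rw [← sum_pow_card_ne_zero_zmod_three m ε, ← Finset.add_sum_erase univ _ (mem_univ (0 : Fin m → ZMod 3))]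
  simp

/-- `(1 + x)^m − 1 ≤ m·x·(1 + x)^{m−1}` for `x ≥ 0` (geometric sum: `(1+x)^m − 1 = x·Σ_{k<m}(1+x)^k`
and each term is `≤ (1+x)^{m−1}`).
[cite: AlonSpencer2016, Ch. 1 «The Basic Method» — elementary estimate supplied here] -/
theorem one_add_pow_sub_one_le {x : ℝ} (hx : 0 ≤ x) (m : ℕ) :
    (1 + x) ^ m - 1 ≤ m * x * (1 + x) ^ (m - 1) := by
  have hgeom : (∑ k ∈ range m, (1 + x) ^ k) * x = (1 + x) ^ m - 1 := by
    have h := geom_sum_mul (1 + x) m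
    rwa [add_sub_cancel_left] at h
  have hterm : ∀ k ∈ range m, (1 + x) ^ k ≤ (1 + x) ^ (m - 1) := fun k hk =>
    pow_le_pow_right₀ (by linarith) (Nat.le_sub_one_of_lt (mem_range.1 hk))
  have hsum : ∑ k ∈ range m, (1 + x) ^ k ≤ m * (1 + x) ^ (m - 1) := by
    calc ∑ k ∈ range m, (1 + x) ^ k ≤ ∑ _k ∈ range m, (1 + x) ^ (m - 1) := sum_le_sum hterm
      _ = m * (1 + x) ^ (m - 1) := by rw [sum_const, card_range, nsmul_eq_mul]
  calc (1 + x) ^ m - 1 = (∑ k ∈ range m, (1 + x) ^ k) * x := hgeom.symm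
    _ ≤ (m * (1 + x) ^ (m - 1)) * x := mul_le_mul_of_nonneg_right hsum hx
    _ = m * x * (1 + x) ^ (m - 1) := by ring

/-- The budget in the form used for error terms: for `0 ≤ ε`,
`Σ_{t ≠ 0} ε^{|t|₀} ≤ 2·m·ε·(1 + 2ε)^{m−1}` (`t : Fin m → ZMod 3`).
[cite: AlonSpencer2016, Ch. 1 «The Basic Method» — elementary estimate supplied here] -/
theorem sum_erase_zero_pow_card_ne_zero_zmod_three_le {ε : ℝ} (hε : 0 ≤ ε) (m : ℕ) :
    ∑ t ∈ (univ : Finset (Fin m → ZMod 3)).erase 0, ε ^ (univ.filter fun i => t i ≠ 0).card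
      ≤ 2 * m * ε * (1 + 2 * ε) ^ (m - 1) := by
  rw [sum_erase_zero_pow_card_ne_zero_zmod_three]
  have h := one_add_pow_sub_one_le (x := 2 * ε) (by linarith) m
  linarith

end Weight

end Literature.Combinatorics.SetFamily
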